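import Literature.AlgebraicGeometry.Motives.SplitForms
import Literature.RingTheory.MvPolynomial.VariableIdeals
import Literature.AlgebraicGeometry.Motives.ProjectiveSpaceLinearSubspaces
import Mathlib.Algebra.MvPolynomial.Division
import Mathlib.RingTheory.Polynomial.UniqueFactorization
import HarnessLib

/-!
# The strata of a split quadric: the forms `splitFormAt s m` and the primes of the quadric cones

The cellular decomposition of the split quadric `V₊(x₀x₁ + x₂x₃ + ⋯) ⊆ ℙᴺ` (Fulton, *Intersection
Theory*, Example 1.9.1; used for `CH₁` of smooth quadric hypersurfaces) runs through the strata
`T(s, m) = V₊(x₀, …, x_{s-1}, q_{s,m})`, `q_{s,m} = splitFormAt s m = x_s x_{s+1} + x_{s+2}x_{s+3} + ⋯`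
the split form on the block of variables `x_s, …, x_{s+m-1}` (`+ x_{s+m-1}²` when `m` is odd).
This file supplies the algebra of these forms and the **generic points of the strata**:

* `splitFormAt` and its recursion `q_{s,m+2} = x_s x_{s+1} + q_{s+2,m}` (`splitFormAt_add_two`),
  homogeneity, evaluation, non-vanishing, invariance under killing variables outside the block;
* `prime_X_mul_X_add` — **`x_a x_b + r` is prime** in `k[x₀, …, x_N]` when `r ≠ 0` involves
  neither `x_a` nor `x_b` (as a polynomial in `x_a` over the UFD `k[x_j : j ≠ a]` it is
  `x_b · x_a + r`, primitive of degree one: Mathlib `Polynomial.irreducible_C_mul_X_add_C`);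
  hence `prime_splitFormAt` for `m ≥ 3`;
* `isPrime_coneIdeal` — the ideal `(x₀, …, x_{s-1}, q_{s,m})` is prime for `m ≥ 3` (kernel of
  `kill (x_{<s}) ≫ (mod q)` into a domain), homogeneous and relevant, whence a point
  `stratumPoint` of `ℙᴺ` with `closure {stratumPoint} = T(s, m)` (`closure_stratumPoint`).

Everything is proved; no named facts.

## References

* W. Fulton, *Intersection Theory*, Example 1.9.1. [Fulton1998]
* R. Hartshorne, *Algebraic Geometry*, I Ex. 2.9, II Prop. 2.5. [Hartshorne1977]
-/

noncomputable section

open CategoryTheory AlgebraicGeometry Order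

universe u

namespace Literature.AlgebraicGeometry.Motives

namespace ProjectiveSpaceCells

open _root_.MvPolynomial



/-! ### `x_a x_b + r` is prime -/

section Prime

variable {k : Type u} [Field k] {N : ℕ}

/-- **`x_a x_b + r` is prime in `k[x₀, …, x_N]`** for distinct variables `x_a, x_b` and a nonzero
`r` involving neither `x_a` nor `x_b` (i.e. fixed by killing `x_a` and by killing `x_b`): as a
polynomial in `x_a` over the UFD `k[x_j : j ≠ a]` it is `x_b · x_a + r`, of degree one with
relatively prime coefficients (`x_b` is prime and does not divide `r`), hence irreducible
(Mathlib `Polynomial.irreducible_C_mul_X_add_C`), hence prime. [folklore] -/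
theorem prime_X_mul_X_add {a b : Fin (N + 1)} (hab : a ≠ b) {r : MvPolynomial (Fin (N + 1)) k}
    (hra : killSet k {a} r = r) (hrb : killSet k {b} r = r) (hr : r ≠ 0) :
    Prime (MvPolynomial.X a * MvPolynomial.X b + r) := by
  classical
  -- single out the variable `x_a`
  let Ψ : MvPolynomial (Fin (N + 1)) k ≃ₐ[k] Polynomial (MvPolynomial (Fin N) k) :=
    (MvPolynomial.renameEquiv k (finSuccEquiv' a)).trans (MvPolynomial.optionEquivLeft k (Fin N))
  have hΨa : Ψ (MvPolynomial.X a) = Polynomial.X := by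
    simp [Ψ, MvPolynomial.renameEquiv_apply, finSuccEquiv'_at, MvPolynomial.optionEquivLeft_X_none]
  -- the images of the other variables are constants
  obtain ⟨b', hb'⟩ : ∃ b' : Fin N, finSuccEquiv' a b = some b' :=
    Option.ne_none_iff_exists'.mp (by
      rw [Ne, ← finSuccEquiv'_at a]; exact fun h ↦ hab ((finSuccEquiv' a).injective h).symm)
  have hΨb : Ψ (MvPolynomial.X b) = Polynomial.C (MvPolynomial.X b') := by
    simp [Ψ, MvPolynomial.renameEquiv_apply, hb', MvPolynomial.optionEquivLeft_X_some]
  let g : Fin (N + 1) → MvPolynomial (Fin N) k := fun j ↦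
    if j = a then 0 else ((finSuccEquiv' a j).elim 0 MvPolynomial.X)
  have hΨX : ∀ j, j ≠ a → Ψ (MvPolynomial.X j) = Polynomial.C (g j) := by
    intro j hj
    obtain ⟨j', hj'⟩ : ∃ j' : Fin N, finSuccEquiv' a j = some j' :=
      Option.ne_none_iff_exists'.mp (by
        rw [Ne, ← finSuccEquiv'_at a]; exact fun h ↦ hj ((finSuccEquiv' a).injective h))
    simp [Ψ, g, MvPolynomial.renameEquiv_apply, hj', hj, MvPolynomial.optionEquivLeft_X_some]
  -- `Ψ r = C r'` with `r' = aeval g r`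
  have hΨkill : (Ψ : MvPolynomial (Fin (N + 1)) k →ₐ[k] _).comp (killSet k {a}) =
        (Polynomial.CAlgHom (R := k) (A := MvPolynomial (Fin N) k)).comp (MvPolynomial.aeval g) := by
    refine MvPolynomial.algHom_ext fun j ↦ ?_
    by_cases hj : j = a
    · subst hj
      simp [g, killSet_X_of_mem (Set.mem_singleton j)]
    · simp only [AlgHom.coe_comp, Function.comp_apply, AlgEquiv.coe_toAlgHom,
        killSet_X_of_notMem (show j ∉ ({a} : Set (Fin (N + 1))) from hj)]
      rw [hΨX j hj, MvPolynomial.aeval_X]; rfl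
  set r' := MvPolynomial.aeval g r with hr'
  have hΨr : Ψ r = Polynomial.C r' := by
    have h := congr($hΨkill r)
    simp only [AlgHom.coe_comp, Function.comp_apply, AlgEquiv.coe_toAlgHom, hra] at h
    exact h
  have hr'0 : r' ≠ 0 := fun h0 ↦ hr (by
    apply Ψ.injective
    rw [hΨr, h0, map_zero, map_zero])
  -- `x_{b'}` does not divide `r'`
  let killb' : MvPolynomial (Fin N) k →ₐ[k] MvPolynomial (Fin N) k :=
    MvPolynomial.aeval fun j ↦ if j = b' then 0 else MvPolynomial.X j
  have hkill' : killb'.comp (MvPolynomial.aeval g) = (MvPolynomial.aeval g).comp (killSet k {b}) := by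
    refine MvPolynomial.algHom_ext fun j ↦ ?_
    by_cases hjb : j = b
    · subst hjb
      simp [killb', g, hb', Ne.symm hab, killSet_X_of_mem (Set.mem_singleton j)]
    · rw [AlgHom.coe_comp, Function.comp_apply, AlgHom.coe_comp, Function.comp_apply,
        killSet_X_of_notMem (show j ∉ ({b} : Set (Fin (N + 1))) from hjb)]
      by_cases hja : j = a
      · subst hja; simp [killb', g]
      · obtain ⟨j', hj'⟩ : ∃ j' : Fin N, finSuccEquiv' a j = some j' :=
          Option.ne_none_iff_exists'.mp (by
            rw [Ne, ← finSuccEquiv'_at a]; exact fun h ↦ hja ((finSuccEquiv' a).injective h))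
        have hj'b' : j' ≠ b' := by
          intro h; subst h
          exact hjb ((finSuccEquiv' a).injective (hj'.trans hb'.symm))
        simp [killb', g, hj', hja, hj'b']
  have hndvd : ¬ MvPolynomial.X b' ∣ r' := by
    rintro ⟨t, ht⟩
    apply hr'0
    have h1 : killb' r' = r' := by
      have h := congr($hkill' r)
      simp only [AlgHom.coe_comp, Function.comp_apply, hrb] at h
      exact h
    rw [← h1, ht, map_mul]
    simp [killb']
  have hrel : IsRelPrime (MvPolynomial.X b' : MvPolynomial (Fin N) k) r' :=
    (MvPolynomial.X_prime (R := k) (σ := Fin N) (i := b')).irreducible.isRelPrime_iff_not_dvd.mpr hndvd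
  have hirr : Irreducible (Polynomial.C (MvPolynomial.X b') * Polynomial.X + Polynomial.C r') :=
    Polynomial.irreducible_C_mul_X_add_C (MvPolynomial.X_ne_zero b') hrel
  have hΨq : Ψ (MvPolynomial.X a * MvPolynomial.X b + r) =
      Polynomial.C (MvPolynomial.X b') * Polynomial.X + Polynomial.C r' := by
    rw [map_add, map_mul, hΨa, hΨb, hΨr, mul_comm]
  have hirr' : Irreducible (MvPolynomial.X a * MvPolynomial.X b + r) := by
    rw [← MulEquiv.irreducible_iff Ψ.toMulEquiv]
    change Irreducible (Ψ _)
    rwa [hΨq]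
  exact UniqueFactorizationMonoid.irreducible_iff_prime.mp hirr'

/-- **The block split form with `m ≥ 3` variables is prime** (`x_s x_{s+1} + q_{s+2,m-2}` with
`q_{s+2,m-2} ≠ 0` in other variables). [folklore] -/
theorem prime_splitFormAt (s m : ℕ) (h : s + m ≤ N + 1) (hm : 3 ≤ m) : Prime (splitFormAt k s m h) := by
  classical
  obtain ⟨m', rfl⟩ : ∃ m', m = m' + 2 := ⟨m - 2, by omega⟩
  rw [splitFormAt_add_two]
  refine prime_X_mul_X_add (fun h ↦ by simp [Fin.ext_iff] at h) ?_ ?_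
    (splitFormAt_ne_zero _ _ _ (by omega))
  · exact killSet_splitFormAt (s + 2) m' (by omega) _ fun j hj ↦ by
      left; rw [Set.mem_singleton_iff] at hj; rw [hj]; simp
  · exact killSet_splitFormAt (s + 2) m' (by omega) _ fun j hj ↦ by
      left; rw [Set.mem_singleton_iff] at hj; rw [hj]; simp

end Prime

/-! ### The primes of the quadric cones and the generic points of the strata -/

section Cone

variable {k : Type u} [Field k] {N : ℕ}

attribute [local instance] MvPolynomial.gradedAlgebra

local notation "𝓐" => MvPolynomial.homogeneousSubmodule (Fin (N + 1)) k

/-- The generators `x₀, …, x_{s-1}, q_{s,m}` of the cone ideal. [folklore] -/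
def coneGens (s m : ℕ) (h : s + m ≤ N + 1) : Set (MvPolynomial (Fin (N + 1)) k) :=
  (fun j ↦ (MvPolynomial.X j : MvPolynomial (Fin (N + 1)) k)) '' {j : Fin (N + 1) | (j : ℕ) < s} ∪
    {splitFormAt k s m h}

/-- **The stratum `T(s, m) = V₊(x₀, …, x_{s-1}, q_{s,m}) ⊆ ℙᴺ`** (a cone with vertex the last
`N + 1 - s - m` coordinates over the split quadric in `m` variables). [folklore] -/
def stratum (s m : ℕ) (h : s + m ≤ N + 1) : Set ↥(Proj 𝓐) :=
  ProjectiveSpectrum.zeroLocus 𝓐 (coneGens (k := k) s m h)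

/-- The cone ideal is homogeneous. [folklore] -/
theorem isHomogeneous_span_coneGens (s m : ℕ) (h : s + m ≤ N + 1) :
    (Ideal.span (coneGens (k := k) s m h)).IsHomogeneous 𝓐 :=
  Ideal.homogeneous_span _ _ (by
    rintro x (⟨j, -, rfl⟩ | hx)
    · exact ⟨1, X_mem_homogeneousSubmodule_one j⟩
    · rw [Set.mem_singleton_iff] at hx
      exact ⟨2, hx ▸ (MvPolynomial.mem_homogeneousSubmodule 2 _).mpr (isHomogeneous_splitFormAt s m h)⟩)

/-- **The cone ideal `(x₀, …, x_{s-1}, q_{s,m})` is prime for `m ≥ 3`**: it is the kernel of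
`k[x] → k[x] ⧸ (q_{s,m})`, `xⱼ ↦ 0 (j < s)`, into a domain (`q_{s,m}` is prime and is fixed by
killing `x_{<s}`). [folklore] -/
theorem isPrime_span_coneGens (s m : ℕ) (h : s + m ≤ N + 1) (hm : 3 ≤ m) :
    (Ideal.span (coneGens (k := k) s m h)).IsPrime := by
  classical
  set q := splitFormAt k s m h with hq
  have hqP : (Ideal.span {q}).IsPrime :=
    (Ideal.span_singleton_prime (splitFormAt_ne_zero s m h (by omega))).mpr
      (prime_splitFormAt s m h hm)
  haveI : IsDomain (MvPolynomial (Fin (N + 1)) k ⧸ Ideal.span {q}) :=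
    (Ideal.Quotient.isDomain_iff_prime _).mpr hqP
  let S : Set (Fin (N + 1)) := {j | (j : ℕ) < s}
  let φ : MvPolynomial (Fin (N + 1)) k →ₐ[k] MvPolynomial (Fin (N + 1)) k ⧸ Ideal.span {q} :=
    (Ideal.Quotient.mkₐ k (Ideal.span {q})).comp (killSet k S)
  have hkq : killSet k S q = q := killSet_splitFormAt s m h S fun j hj ↦ Or.inl hj
  have hker : RingHom.ker φ = Ideal.span (coneGens (k := k) s m h) := by
    apply le_antisymm
    · intro p hp
      rw [RingHom.mem_ker] at hp
      change Ideal.Quotient.mk (Ideal.span {q}) (killSet k S p) = 0 at hp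
      rw [Ideal.Quotient.eq_zero_iff_mem] at hp
      have hsplit : p = killSet k S p + (p - killSet k S p) := by ring
      rw [hsplit]
      refine Ideal.add_mem _ (Ideal.span_mono (Set.subset_union_right) hp)
        (Ideal.span_mono (Set.subset_union_left) (sub_killSet_mem S p))
    · rw [Ideal.span_le]
      rintro x (⟨j, hj, rfl⟩ | hx)
      · rw [SetLike.mem_coe, RingHom.mem_ker]
        change Ideal.Quotient.mk (Ideal.span {q}) (killSet k S (MvPolynomial.X j)) = 0
        rw [killSet_X_of_mem hj, map_zero]
      · rw [Set.mem_singleton_iff] at hx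
        subst hx
        rw [SetLike.mem_coe, RingHom.mem_ker]
        change Ideal.Quotient.mk (Ideal.span {q}) (killSet k S q) = 0
        rw [hkq, Ideal.Quotient.eq_zero_iff_mem]
        exact Ideal.subset_span rfl
  rw [← hker]
  exact RingHom.ker_isPrime _

/-- The block form vanishes at the coordinate point `e_{s+1}`. [folklore] -/
theorem eval_splitFormAt_single_succ (s m : ℕ) (h : s + m ≤ N + 1) :
    MvPolynomial.eval (fun j : Fin (N + 1) ↦ if (j : ℕ) = s + 1 then (1 : k) else 0)
      (splitFormAt k s m h) = 0 := by
  rw [eval_splitFormAt]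
  refine Finset.sum_eq_zero fun i _ ↦ ?_
  by_cases hc : s ≤ (i : ℕ) ∧ (i : ℕ) < s + m ∧ ((i : ℕ) - s) % 2 = 0
  · have hu : (if (i : ℕ) = s + 1 then (1 : k) else 0) = 0 := by rw [if_neg]; omega
    rw [if_pos hc]
    simp only [hu, zero_mul, dite_eq_ite, ite_self]
  · rw [if_neg hc]

/-- `x_{s+1}` is not in the cone ideal (evaluate at `e_{s+1}`). [folklore] -/
theorem X_succ_notMem_span_coneGens (s m : ℕ) (h : s + m ≤ N + 1) (hm : 2 ≤ m) :
    (MvPolynomial.X ⟨s + 1, by omega⟩ : MvPolynomial (Fin (N + 1)) k) ∉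
      Ideal.span (coneGens (k := k) s m h) := by
  intro hX
  let ev := MvPolynomial.eval (fun j : Fin (N + 1) ↦ if (j : ℕ) = s + 1 then (1 : k) else 0)
  have hle : Ideal.span (coneGens (k := k) s m h) ≤ RingHom.ker ev := by
    rw [Ideal.span_le]
    rintro x (⟨j, hj, rfl⟩ | hx)
    · rw [SetLike.mem_coe, RingHom.mem_ker, MvPolynomial.eval_X, if_neg]
      simp only [Set.mem_setOf_eq] at hj
      omega
    · rw [Set.mem_singleton_iff] at hx
      subst hx
      exact eval_splitFormAt_single_succ s m h
  have h1 := hle hX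
  rw [RingHom.mem_ker, MvPolynomial.eval_X, if_pos rfl] at h1
  exact one_ne_zero h1

/-- **The generic point of the stratum `T(s, m)`** (`m ≥ 3`): the relevant homogeneous prime
`(x₀, …, x_{s-1}, q_{s,m})` as a point of `ℙᴺ_k`. [cite: Hartshorne1977, II Prop. 2.5] -/
def stratumPoint (s m : ℕ) (h : s + m ≤ N + 1) (hm : 3 ≤ m) : ↥(Proj 𝓐) :=
  (⟨⟨Ideal.span (coneGens (k := k) s m h), isHomogeneous_span_coneGens s m h⟩,
    isPrime_span_coneGens s m h hm, fun hle ↦ by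
      have hX : (MvPolynomial.X ⟨s + 1, by omega⟩ : MvPolynomial (Fin (N + 1)) k) ∈
          HomogeneousIdeal.irrelevant 𝓐 :=
        HomogeneousIdeal.mem_irrelevant_of_mem _ zero_lt_one (X_mem_homogeneousSubmodule_one _)
      exact X_succ_notMem_span_coneGens s m h (by omega) (hle hX)⟩ : ProjectiveSpectrum 𝓐)

/-- The homogeneous ideal of `stratumPoint` is the cone ideal (`rfl`). [folklore] -/
theorem toIdeal_stratumPoint (s m : ℕ) (h : s + m ≤ N + 1) (hm : 3 ≤ m) :
    (ProjectiveSpectrum.asHomogeneousIdeal (𝒜 := 𝓐) (stratumPoint (k := k) s m h hm)).toIdeal =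
      Ideal.span (coneGens (k := k) s m h) :=
  rfl

/-- **`closure {stratumPoint} = T(s, m)`**: the stratum is irreducible with this generic point.
[cite: Hartshorne1977, II Prop. 2.5] -/
theorem closure_stratumPoint (s m : ℕ) (h : s + m ≤ N + 1) (hm : 3 ≤ m) :
    closure {stratumPoint (k := k) s m h hm} = stratum (k := k) s m h := by
  have hc := closure_singleton_eq_zeroLocus (N := N) (k := k) (stratumPoint s m h hm)
  rw [stratum, ← ProjectiveSpectrum.zeroLocus_span]
  exact hc

/-- The generic point lies on the stratum. [folklore] -/
theorem stratumPoint_mem_stratum (s m : ℕ) (h : s + m ≤ N + 1) (hm : 3 ≤ m) :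
    stratumPoint (k := k) s m h hm ∈ stratum (k := k) s m h := by
  rw [← closure_stratumPoint s m h hm]
  exact subset_closure rfl

end Cone

end ProjectiveSpaceCells

end Literature.AlgebraicGeometry.Motives
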